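import Summits.BirchSwinnertonDyer.BirchSwinnertonDyer.Theses.InertBadSignedBranches
import Summits.BirchSwinnertonDyer.Rank1Residual.X12.InertCoreEveryCurve
import Summits.BirchSwinnertonDyer.Rank1Residual.X12.CMTamagawaThreeAll
import Summits.BirchSwinnertonDyer.Rank1Residual.X12.ClassClosureO10RubinEta
import Literature.NumberTheory.EllipticCurves.ManinConstantConductorLe300000
import Literature.NumberTheory.EllipticCurves.BSDSelmerCMPConverseMaximalOrderProofs
import HarnessLib

/-!
# Route `InertBadSignedBranches` (rung K8), D71 child `InertBadAtThreeIstarZero` (stmt-BirchSwinnertonDyer-19656):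
# conductor `≤ 300000` — the upper half of `BSD₃` for EVERY curve of the type `(3, I₀*)` from published facts
# ALONE (Cremona's `c = 1` for optimal curves, as cited by Česnavičius–Neururer–Saha, in place of the per-pair
# Manin datum), hence: in Cremona's range the child IS its lower half
# (helper `--supports` 19656; cell `bsd-cm`, seat `bsd-cm-k8i-c41` g3; theorems only, nothing asserted)

HONEST FRAMING (cell `bsd-cm`, run/shared/lean/pub/bsd-cm/): Birch–Swinnerton-Dyer is NOT proved by
any of this. The item `InertBadAtThreeIstarZero` is OPEN at class level and stays so. Its
Kolyvagin-side normal form (inert g11, p416932) is «child ⟸ `LowerHalfOnType 3 I₀*` + eight published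
facts + a Manin datum `3 ∤ c(D)` for EVERY curve `W` of the type»; at CLASS level that datum is in no
source (this seat's reading: ARS06 §2, Edixhoven 1991 Thm. 3 is `p ≥ 11`, CNS Thm. 1.2 per pair only).
THIS FILE is the `p = 3` twin of x1b's `X12/InertCoreEveryCurveCremona.lean` (`p ≥ 5`, `N ≤ 130000`):
for conductor `≤ 300000` the Manin datum is DISCHARGED for the (unidentified) `X₀(N)`-OPTIMAL member
`W₀ ∼ W` of the isogeny class — supplied by Modularity (`X12.exists_isIsogenous_optimal`: a
lattice-optimal datum at the common conductor level) — by the NAMED FACT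
`cremona_abs_maninConstant_eq_one_of_level_le_300000` (Cremona's verification `c = ±1` for every
optimal curve of conductor `≤ 300000`, as cited in print by Česnavičius–Neururer–Saha, JEMS 26 (2024)
§1); the upper half at `3` of x1b's `X12.missingUpperBoundAt_three_of_classX12_of_bad'`
(Kolyvagin–Matar–Nekovář over a Friedberg–Hoffstein field; the rank-zero CM twist by Rubin /
Burungale–Flach; `3 ∤ ∏ c_ℓ` by Kodaira–Néron for `K ≠ ℚ(√−3)`) then holds for `W₀`, and Cassels'
isogeny invariance of `#Ш_an/#Ш` (`bsdRHS_eq_of_isIsogenous`, x1b's `missingUpperBoundAt_of_isIsogenous`)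
moves it to `W`. No class list, no table row, no identification of the optimal curve, no modular degree.
CENSUS: 42 of the 57 O10-PS@3 classes (and 66 of the 97 O10-SC@3) have `N ≤ 300000`; there the ONLY
open input of 19656 is `LowerHalfOnType 3 I₀*` itself. THEOREMS ONLY: 0 definitions, 0 named facts
minted, 0 `sorry`.

PARTITION (D-0054): CornerF inert-bad (B12 / O10) × O10-PS@3 ∩ {N ≤ 300000} (42 of 57 classes of
signed type `(3, I₀*)`; the statements are type-free and also cover O10-SC@3 ∩ {N ≤ 300000}) × `p = 3` —
types-the-object-of; closes no cell, books nothing, moves no mark.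

* §1 `missingUpperBoundAt_three_of_classX12_of_bad_of_conductorNorm_le` — EVERY globally minimal `W`
  with `ClassX12 W 3`, bad at `3`, `3 ∤ d_K`, `N_W ≤ 300000`: `MissingUpperBoundAt W 3`.
* §2 `bsdp_three_iff_missingLowerBoundAt_of_conductorNorm_le`, `missingInputAt_three_of_lower_of_conductorNorm_le`,
  `missingInputAt_three_of_shaAn_unit_of_conductorNorm_le` (route T-KR@3 for every curve, `N ≤ 300000`,
  Manin input = the named fact).
* §3 on the type: `inertBadAtThreeIstarZero_of_lowerHalfOnType_three_of_conductorNorm_le` — given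
  `LowerHalfOnType 3 I₀*`, the child's conclusion holds at every `W` of the type with `N_W ≤ 300000`
  (p416932 §2 with `hManin` GONE in that range).

References (locators only): [CesnaviciusNeururerSaha2023] §1 (Cremona's verification, `N ≤ 300000`);
[Cremona2022ManinConstants] ¶ "Concerning the Manin constant"; [AgasheRibetStein2006] Thm. 2.6;
[MatarNekovar2019] Thm. 0.3, §0.11; [MilneADT2006] Thm. I.7.3, Rem. I.7.4 (Cassels); [PastenShimura2024]
§2 (optimal quotient); [SilvermanAEC2009] Cor. VII.7.2; [Miller2011LMS] §1, Def. 1.1.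
-/

set_option autoImplicit false
set_option linter.dupNamespace false

noncomputable section

open scoped Classical NumberField

open WeierstrassCurve NumberField IsDedekindDomain
open Literature.NumberTheory.EllipticCurves
open Literature.NumberTheory.EllipticCurves.ModularForms
open Literature.NumberTheory.EllipticCurves.Rank1Residual
open Literature.NumberTheory.EllipticCurves.Rank1Residual.Typed
open Summit.BirchSwinnertonDyer.Rank1Residual
open Summit.BirchSwinnertonDyer.Rank1Residual.X12
open Summit.BirchSwinnertonDyer.Rank1Residual.X12.O10

namespace Summit.BirchSwinnertonDyer.BirchSwinnertonDyer.Theorems.InertBadAtThreeEveryCurve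

section Facts

/-! The PUBLISHED named facts: the eight of route T-KR@3, Cremona's `c = 1` to `300000` (as cited by
CNS 2024 §1) and Cassels' isogeny invariance. -/
variable
  (hGZ : ∀ (N : ℕ) [NeZero N] (W : WeierstrassCurve ℚ) (K : Type) [Field K] [NumberField K],
    gross_zagier N W K)
  (hKo : ∀ (N : ℕ) [NeZero N] (W : WeierstrassCurve ℚ) (K : Type) [Field K] [NumberField K],
    kolyvagin N W K)
  (hMN : ∀ (N : ℕ) [NeZero N] (W : WeierstrassCurve ℚ) (K : Type) [Field K] [NumberField K],
    MatarNekovar2019.thm03_padicValNat_card_sha_le_of_irreducible N W K)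
  (hGZK : rank_eq_analyticRank_of_analyticRank_le_one) (hmod : hasEntireLFunction_rat)
  (hnf : exists_isNewformOf) (hFH : friedbergHoffstein_exists_heegnerField_split_twist_ne_zero)
  (hCM8 : bsdTriple_of_hasCM_of_L_one_ne_zero)
  (h300 : cremona_abs_maninConstant_eq_one_of_level_le_300000)
  (hCassels : bsdRHS_eq_of_isIsogenous)

include hGZ hKo hMN hGZK hmod hnf hFH hCM8 h300 hCassels

/-! ## §1 The upper half of `BSD(W, 3)` for EVERY curve of conductor `≤ 300000` (X12 at `3`, bad, `3 ∤ d_K`) -/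

/-- **X12 at `p = 3`, `3 ∣ N`, `K ≠ ℚ(√−3)`, conductor `≤ 300000`, EVERY CURVE: the UPPER half of
`BSD(W, 3)` from published facts ALONE.** For every globally minimal `W/ℚ` with `ClassX12 W 3`, bad at
`3`, `3 ∤ d_K` and `N_W ≤ 300000`: `MissingUpperBoundAt W 3` (`ord₃ #Ш ≤ ord₃ #Ш_an`). Proof: the strong
member `W₀ ∼ W` with a lattice-optimal datum `D₀` at level `N_{W₀} = N_W` (Modularity,
`X12.exists_isIsogenous_optimal`); `3 ∤ c(D₀)` by Cremona-to-`300000` (`h300`); `ClassX12`, `3 ∤ d_K`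
and bad reduction at `3` pass to `W₀` along the isogeny; x1b's upper half at `3` for `W₀`; Cassels
(`hCassels`) carries it to `W`. CONDITIONAL on the displayed named facts; nothing booked.
[cite: CesnaviciusNeururerSaha2023, §1] [cite: MatarNekovar2019, Thm. 0.3 and §0.11]
[cite: MilneADT2006, Thm. I.7.3 and Remark I.7.4] [cite: SilvermanAEC2009, Cor. VII.7.2] -/
theorem missingUpperBoundAt_three_of_classX12_of_bad_of_conductorNorm_le
    (W : WeierstrassCurve ℚ) [W.IsElliptic] [W.IsGloballyMinimal] [Fact (Nat.Prime 3)]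
    (hX : ClassX12 W 3) (hbad : ¬ Good W 3) (hnr : ¬ CMRamified W 3)
    (hN : W.conductorNorm ℤ ≤ 300000) : MissingUpperBoundAt W 3 := by
  obtain ⟨W₀, hE₀, hM₀, hN₀, D₀, hiso, hNeq, hopt⟩ := exists_isIsogenous_optimal hnf W
  have hX₀ : ClassX12 W₀ 3 := (classX12_iff_of_isIsogenous hiso 3).mp hX
  have hnr₀ : ¬ CMRamified W₀ 3 := fun h ↦ hnr ((cmRamified_iff_of_isIsogenous hiso hX.1 3).mpr h)
  have hbad₀ : ¬ Good W₀ 3 := fun h ↦ hbad ((hiso.hasGoodReductionAtPrime_iff 3).mpr h)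
  have hc : ¬ (3 : ℤ) ∣ D₀.c :=
    not_dvd_maninConstant_of_level_le_300000 h300 W₀ D₀ hopt (by rw [hNeq]; exact hN) Nat.prime_three
  have hup₀ : MissingUpperBoundAt W₀ 3 :=
    missingUpperBoundAt_three_of_classX12_of_bad' hGZ hKo hMN hGZK hmod hnf hFH hCM8 W₀ hX₀ hbad₀ hnr₀
      D₀ hc
  exact missingUpperBoundAt_of_isIsogenous hCassels hiso (hGZK W₀ (by rw [hX₀.2.1])).2
    (W₀.leadingLCoeff_ne_zero_holds (hmod W₀)) hup₀

/-! ## §2 `BSD(W, 3) ⟺` the curve's own lower half; route T-KR@3 — every curve, conductor `≤ 300000` -/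

/-- **`BSD(W, 3)` from the curve's OWN lower half, every curve of conductor `≤ 300000`** (X12 at `3`,
bad, `3 ∤ d_K`): no Manin datum, no Tamagawa datum, no table row.
[cite: CesnaviciusNeururerSaha2023, §1] [cite: MatarNekovar2019, Thm. 0.3 and §0.11] [cite: Miller2011LMS, §1 and Def. 1.1] -/
theorem bsdp_three_of_classX12_of_bad_of_conductorNorm_le_of_lower
    (W : WeierstrassCurve ℚ) [W.IsElliptic] [W.IsGloballyMinimal] [Fact (Nat.Prime 3)]
    (hX : ClassX12 W 3) (hbad : ¬ Good W 3) (hnr : ¬ CMRamified W 3)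
    (hN : W.conductorNorm ℤ ≤ 300000) (hlow : MissingLowerBoundAt W 3) : BSDp W 3 :=
  bsdp_of_missingPPartAt W 3 hGZK (by rw [hX.2.1])
    (missingPPartAt_of_lower_of_upper W 3 hlow
      (missingUpperBoundAt_three_of_classX12_of_bad_of_conductorNorm_le hGZ hKo hMN hGZK hmod hnf hFH
        hCM8 h300 hCassels W hX hbad hnr hN))

/-- **`BSD(W, 3) ⟺ MissingLowerBoundAt W 3`, every curve of conductor `≤ 300000`** (X12 at `3`, bad,
`3 ∤ d_K`): "⇐" is the previous theorem, "⇒" is bookkeeping (`Ш` finite by GZK).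
[cite: CesnaviciusNeururerSaha2023, §1] [cite: Miller2011LMS, §1 and Def. 1.1] -/
theorem bsdp_three_iff_missingLowerBoundAt_of_conductorNorm_le
    (W : WeierstrassCurve ℚ) [W.IsElliptic] [W.IsGloballyMinimal] [Fact (Nat.Prime 3)]
    (hX : ClassX12 W 3) (hbad : ¬ Good W 3) (hnr : ¬ CMRamified W 3)
    (hN : W.conductorNorm ℤ ≤ 300000) : BSDp W 3 ↔ MissingLowerBoundAt W 3 := by
  refine ⟨fun hB ↦ ?_, bsdp_three_of_classX12_of_bad_of_conductorNorm_le_of_lower hGZ hKo hMN hGZK hmod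
    hnf hFH hCM8 h300 hCassels W hX hbad hnr hN⟩
  haveI : Finite W.sha := (hGZK W (by rw [hX.2.1])).2
  exact (lower_and_upper_of_missingPPartAt W 3 (missingPPartAt_of_bsdp W 3 hB)).1

/-- **The cell's typed input from the curve's own lower half, every curve of conductor `≤ 300000`**:
`MissingLowerBoundAt W 3 ⟹ Typed.X12.MissingInputAt W 3`. [cite: CesnaviciusNeururerSaha2023, §1]
[cite: Miller2011LMS, §1 and Def. 1.1] -/
theorem missingInputAt_three_of_lower_of_conductorNorm_le
    (W : WeierstrassCurve ℚ) [W.IsElliptic] [W.IsGloballyMinimal] [Fact (Nat.Prime 3)]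
    (hX : ClassX12 W 3) (hbad : ¬ Good W 3) (hnr : ¬ CMRamified W 3)
    (hN : W.conductorNorm ℤ ≤ 300000) (hlow : MissingLowerBoundAt W 3) : X12.MissingInputAt W 3 := by
  intro _
  haveI : Finite W.sha := (hGZK W (by rw [hX.2.1])).2
  exact missingPPartAt_of_bsdp W 3 (bsdp_three_of_classX12_of_bad_of_conductorNorm_le_of_lower hGZ hKo
    hMN hGZK hmod hnf hFH hCM8 h300 hCassels W hX hbad hnr hN hlow)

/-- **Route T-KR@3 for EVERY curve of conductor `≤ 300000`** (X12 at `3`, bad, `3 ∤ d_K`): published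
facts (+ Cremona-to-`300000` + Cassels) + certified `#Ш(W)_an = q` with `ord₃ q = 0` ⟹
`Typed.X12.MissingInputAt W 3` — the Manin input is the named fact, for every member of the class
(not only the curve numbered `1`), with no optimality identification.
[cite: CesnaviciusNeururerSaha2023, §1] [cite: MatarNekovar2019, Thm. 0.3 and §0.11] [cite: Miller2011LMS, Def. 1.1] -/
theorem missingInputAt_three_of_shaAn_unit_of_conductorNorm_le
    (W : WeierstrassCurve ℚ) [W.IsElliptic] [W.IsGloballyMinimal] [Fact (Nat.Prime 3)]
    (hX : ClassX12 W 3) (hbad : ¬ Good W 3) (hnr : ¬ CMRamified W 3)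
    (hN : W.conductorNorm ℤ ≤ 300000)
    {q : ℚ} (hq : shaAn W = (q : ℂ)) (hv : padicValRat 3 q = 0) : X12.MissingInputAt W 3 := by
  refine missingInputAt_three_of_lower_of_conductorNorm_le hGZ hKo hMN hGZK hmod hnf hFH hCM8 h300
    hCassels W hX hbad hnr hN ⟨q, hq, ?_⟩
  rw [hv]
  positivity

/-! ## §3 On the type `(3, I₀*)`: in conductor `≤ 300000` the child IS its lower half -/

/-- **`InertBadAtThreeIstarZero` restricted to conductor `≤ 300000` ⟸ `LowerHalfOnType 3 I₀*` and
published facts ALONE** — p416932 §2 (`inertBadAtThreeIstarZero_of_lowerHalfOnType_three`) with its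
class-level Manin binder `hManin` GONE in Cremona's range: for every globally minimal `W` of signed
local type `(3, I₀*)` with `r_an = 1` and `N_W ≤ 300000`, `Typed.X12.MissingInputAt W 3`. So on 42 of
the 57 O10-PS@3 census classes the ONLY open input of the child is the class target
`LowerHalfOnType 3 I₀*` (the η-branch `3`-adic Gross–Zagier / main-conjecture half; no source).
CONDITIONAL on the displayed facts and on `hlow` (OPEN); nothing booked; 19656 stays OPEN.
[cite: CesnaviciusNeururerSaha2023, §1] [cite: MatarNekovar2019, Thm. 0.3 and §0.11]
[cite: SilvermanATAEC1994, IV.9.4 and Table 4.1] [cite: Miller2011LMS, §1 and Def. 1.1] -/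
theorem inertBadAtThreeIstarZero_of_lowerHalfOnType_three_of_conductorNorm_le
    (hlow : LowerHalfOnType 3 (.Istar 0))
    (W : WeierstrassCurve ℚ) [W.IsElliptic] [W.IsGloballyMinimal] [Fact (Nat.Prime 3)]
    (hT : HasSignedLocalType W 3 (.Istar 0)) (hr : W.analyticRank = 1)
    (hN : W.conductorNorm ℤ ≤ 300000) : X12.MissingInputAt W 3 :=
  missingInputAt_three_of_lower_of_conductorNorm_le hGZ hKo hMN hGZK hmod hnf hFH hCM8 h300 hCassels W
    (classX12_of_hasSignedLocalType W 3 hT hr) hT.2.2.1 hT.2.1.1 hN (hlow W hT hr)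

/-- **Route T-KR@3 on the type, every curve of conductor `≤ 300000`**: published facts + certified
`#Ш(W)_an` a `3`-adic unit ⟹ `Typed.X12.MissingInputAt W 3` (the per-pair closures of O10-PS@3 in
Cremona's range, now for every member of each class and without `opt_man`).
[cite: CesnaviciusNeururerSaha2023, §1] [cite: MatarNekovar2019, Thm. 0.3 and §0.11] -/
theorem missingInputAt_three_IstarZero_of_shaAn_unit_of_conductorNorm_le
    (W : WeierstrassCurve ℚ) [W.IsElliptic] [W.IsGloballyMinimal] [Fact (Nat.Prime 3)]
    (hT : HasSignedLocalType W 3 (.Istar 0)) (hr : W.analyticRank = 1)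
    (hN : W.conductorNorm ℤ ≤ 300000)
    {q : ℚ} (hq : shaAn W = (q : ℂ)) (hv : padicValRat 3 q = 0) : X12.MissingInputAt W 3 :=
  missingInputAt_three_of_shaAn_unit_of_conductorNorm_le hGZ hKo hMN hGZK hmod hnf hFH hCM8 h300 hCassels
    W (classX12_of_hasSignedLocalType W 3 hT hr) hT.2.2.1 hT.2.1.1 hN hq hv

end Facts

/-! ## §4 (appended, same seat, 2026-08-26) All conductors: the child ⟸ `LowerHalfOnType 3 I₀*` + Manin's
conjecture at `3` for the OPTIMAL curves of the corner (the class-level Manin input in the form in which it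
is conjectured and tabulated — Agashe–Ribet–Stein 2006 Conj. 2.1 «c_E = 1» for optimal `E` — instead of
p416932's per-curve datum `∃ D, 3 ∤ c(D)` for every `W` of the type)

No definition is introduced: Manin's conjecture is NOT a Literature fact (open), so it enters as the
displayed hypothesis `hManinOpt` (lattice-optimal data `Λ_E = c·Λ_f` at the conductor level, restricted
to CM curves with `3` inert and bad at `3`), exactly the binder shape of the tree's Cremona sentences
(`cremona_abs_maninConstant_eq_one_of_level_le[_300000]`, which DISCHARGE it for `N ≤ 130000 / 300000`). -/

section AllConductors

variable
  (hGZ : ∀ (N : ℕ) [NeZero N] (W : WeierstrassCurve ℚ) (K : Type) [Field K] [NumberField K],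
    gross_zagier N W K)
  (hKo : ∀ (N : ℕ) [NeZero N] (W : WeierstrassCurve ℚ) (K : Type) [Field K] [NumberField K],
    kolyvagin N W K)
  (hMN : ∀ (N : ℕ) [NeZero N] (W : WeierstrassCurve ℚ) (K : Type) [Field K] [NumberField K],
    MatarNekovar2019.thm03_padicValNat_card_sha_le_of_irreducible N W K)
  (hGZK : rank_eq_analyticRank_of_analyticRank_le_one) (hmod : hasEntireLFunction_rat)
  (hnf : exists_isNewformOf) (hFH : friedbergHoffstein_exists_heegnerField_split_twist_ne_zero)
  (hCM8 : bsdTriple_of_hasCM_of_L_one_ne_zero)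
  (hCassels : bsdRHS_eq_of_isIsogenous)
  (hManinOpt : ∀ (W₀ : WeierstrassCurve ℚ) [W₀.IsElliptic] [W₀.IsGloballyMinimal]
    [NeZero (W₀.conductorNorm ℤ)], W₀.HasCM → CMInert W₀ 3 → ¬ W₀.HasGoodReductionAtPrime 3 →
    ∀ D₀ : ModularParametrizationData W₀ (W₀.conductorNorm ℤ),
      (∀ z ∈ D₀.L.lattice, ∃ w ∈ periodLattice D₀.f, z = D₀.c * w) → ¬ (3 : ℤ) ∣ D₀.c)

include hGZ hKo hMN hGZK hmod hnf hFH hCM8 hCassels hManinOpt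

/-- **The upper half of `BSD(W, 3)` for EVERY curve of the inert-bad corner at `3`, all conductors,
modulo Manin's conjecture at `3` for the optimal member** (`hManinOpt`): for every globally minimal `W`
with CM, `r_an = 1`, `3` inert in the CM field and bad at `3`: `MissingUpperBoundAt W 3`. Same proof as
§1 with `hManinOpt` in place of Cremona-to-`300000`. CONDITIONAL; nothing booked.
[cite: AgasheRibetStein2006, Conj. 2.1 and §2] [cite: MatarNekovar2019, Thm. 0.3 and §0.11]
[cite: MilneADT2006, Thm. I.7.3 and Remark I.7.4] [cite: SilvermanAEC2009, Cor. VII.7.2] -/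
theorem missingUpperBoundAt_three_of_cmInert_of_bad_of_maninOptimal
    (W : WeierstrassCurve ℚ) [W.IsElliptic] [W.IsGloballyMinimal] [Fact (Nat.Prime 3)]
    (hCM : W.HasCM) (hr : W.analyticRank = 1) (hin : CMInert W 3) (hbad : ¬ Good W 3) :
    MissingUpperBoundAt W 3 := by
  obtain ⟨W₀, hE₀, hM₀, hN₀, D₀, hiso, -, hopt⟩ := exists_isIsogenous_optimal hnf W
  have hX : ClassX12 W 3 := ⟨hCM, hr, Or.inr (Or.inl ⟨rfl, hin.2⟩)⟩
  have hX₀ : ClassX12 W₀ 3 := (classX12_iff_of_isIsogenous hiso 3).mp hX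
  have hin₀ : CMInert W₀ 3 := (cmInert_iff_of_isIsogenous hiso hCM 3).mp hin
  have hbad₀ : ¬ Good W₀ 3 := fun h ↦ hbad ((hiso.hasGoodReductionAtPrime_iff 3).mpr h)
  have hc : ¬ (3 : ℤ) ∣ D₀.c := hManinOpt W₀ hX₀.1 hin₀ hbad₀ D₀ hopt
  have hup₀ : MissingUpperBoundAt W₀ 3 :=
    missingUpperBoundAt_three_of_classX12_of_bad' hGZ hKo hMN hGZK hmod hnf hFH hCM8 W₀ hX₀ hbad₀ hin₀.1
      D₀ hc
  exact missingUpperBoundAt_of_isIsogenous hCassels hiso (hGZK W₀ (by rw [hX₀.2.1])).2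
    (W₀.leadingLCoeff_ne_zero_holds (hmod W₀)) hup₀

/-- **`InertBadAtThreeIstarZero` (19656) ⟸ `X12.O10.LowerHalfOnType 3 I₀*` + published facts + Manin's
conjecture at `3` for the optimal curves of the corner.** The class-level Kolyvagin-side normal form with
the Manin input in conjecture shape (`hManinOpt`) rather than as a per-curve datum: the child's open
content is the main-conjecture half on `(3, I₀*)` (`hlow`, no source) and Manin's conjecture at the
additive prime `3` (no source at class level; Cremona's theorem to `300000`, §3). CONDITIONAL on every
displayed hypothesis; nothing booked; 19656 stays OPEN.
[cite: AgasheRibetStein2006, Conj. 2.1 and §2] [cite: MatarNekovar2019, Thm. 0.3 and §0.11]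
[cite: Miller2011LMS, §1 and Def. 1.1] [cite: SilvermanATAEC1994, IV.9.4 and Table 4.1] -/
theorem inertBadAtThreeIstarZero_of_lowerHalfOnType_three_of_maninOptimal
    (hlow : LowerHalfOnType 3 (.Istar 0)) :
    Summit.BirchSwinnertonDyer.BirchSwinnertonDyer.Theses.InertBadSignedBranches.InertBadAtThreeIstarZero := by
  unfold Summit.BirchSwinnertonDyer.BirchSwinnertonDyer.Theses.InertBadSignedBranches.InertBadAtThreeIstarZero
  intro W _ _ _ hT hr _
  haveI : Finite W.sha := (hGZK W (by rw [hr])).2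
  exact missingPPartAt_of_lower_of_upper W 3 (hlow W hT hr)
    (missingUpperBoundAt_three_of_cmInert_of_bad_of_maninOptimal hGZ hKo hMN hGZK hmod hnf hFH hCM8
      hCassels hManinOpt W hT.1 hr hT.2.1 hT.2.2.1)

end AllConductors

/-! ## §5 (appended, same seat, 2026-08-26) The converse needs no Manin input: child ⟺ `LowerHalfOnType 3 I₀*`
modulo Manin's conjecture at `3` on ONE side only -/

/-- **`InertBadAtThreeIstarZero ⟹ X12.O10.LowerHalfOnType 3 I₀*`** — bookkeeping, GZK only (`Ш` finite
in analytic rank one; `MissingPPartAt` gives both halves; `3` is not split in the CM field on the type, so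
the `X12.MissingInputAt` guard is met). No Manin input, no Kolyvagin. [cite: Miller2011LMS, §1 and Def. 1.1] -/
theorem lowerHalfOnType_three_IstarZero_of_inertBadAtThreeIstarZero
    (hGZK : rank_eq_analyticRank_of_analyticRank_le_one)
    (h : Summit.BirchSwinnertonDyer.BirchSwinnertonDyer.Theses.InertBadSignedBranches.InertBadAtThreeIstarZero) :
    LowerHalfOnType 3 (.Istar 0) := by
  refine lowerHalfOnType_of_forall_bsdp hGZK fun W _ _ hT hr ↦ ?_
  have h' := h
  unfold Summit.BirchSwinnertonDyer.BirchSwinnertonDyer.Theses.InertBadSignedBranches.InertBadAtThreeIstarZero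
    at h'
  exact bsdp_of_missingPPartAt W 3 hGZK (by rw [hr])
    (h' W hT hr fun hs ↦ not_cmSplit_of_hasSignedLocalType W 3 hT hs.2)

/-- **`InertBadAtThreeIstarZero ⟺ X12.O10.LowerHalfOnType 3 I₀*` modulo the published facts and Manin's
conjecture at `3` for the optimal curves of the corner** (`hManinOpt`, used only for "⇐") — g0's
`InertBadAtThreeIff.inertBadAtThreeIstarZero_iff_lowerHalfOnType_three` (p419176) with the per-curve
Manin datum `hManin` replaced by the conjecture-shaped `hManinOpt`. CONDITIONAL; nothing booked.
[cite: AgasheRibetStein2006, Conj. 2.1] [cite: MatarNekovar2019, Thm. 0.3 and §0.11] [cite: Miller2011LMS, §1 and Def. 1.1] -/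
theorem inertBadAtThreeIstarZero_iff_lowerHalfOnType_three_of_maninOptimal
    (hGZ : ∀ (N : ℕ) [NeZero N] (W : WeierstrassCurve ℚ) (K : Type) [Field K] [NumberField K],
      gross_zagier N W K)
    (hKo : ∀ (N : ℕ) [NeZero N] (W : WeierstrassCurve ℚ) (K : Type) [Field K] [NumberField K],
      kolyvagin N W K)
    (hMN : ∀ (N : ℕ) [NeZero N] (W : WeierstrassCurve ℚ) (K : Type) [Field K] [NumberField K],
      MatarNekovar2019.thm03_padicValNat_card_sha_le_of_irreducible N W K)
    (hGZK : rank_eq_analyticRank_of_analyticRank_le_one) (hmod : hasEntireLFunction_rat)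
    (hnf : exists_isNewformOf) (hFH : friedbergHoffstein_exists_heegnerField_split_twist_ne_zero)
    (hCM8 : bsdTriple_of_hasCM_of_L_one_ne_zero)
    (hCassels : bsdRHS_eq_of_isIsogenous)
    (hManinOpt : ∀ (W₀ : WeierstrassCurve ℚ) [W₀.IsElliptic] [W₀.IsGloballyMinimal]
      [NeZero (W₀.conductorNorm ℤ)], W₀.HasCM → CMInert W₀ 3 → ¬ W₀.HasGoodReductionAtPrime 3 →
      ∀ D₀ : ModularParametrizationData W₀ (W₀.conductorNorm ℤ),
        (∀ z ∈ D₀.L.lattice, ∃ w ∈ periodLattice D₀.f, z = D₀.c * w) → ¬ (3 : ℤ) ∣ D₀.c) :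
    Summit.BirchSwinnertonDyer.BirchSwinnertonDyer.Theses.InertBadSignedBranches.InertBadAtThreeIstarZero ↔
      LowerHalfOnType 3 (.Istar 0) :=
  ⟨lowerHalfOnType_three_IstarZero_of_inertBadAtThreeIstarZero hGZK,
    inertBadAtThreeIstarZero_of_lowerHalfOnType_three_of_maninOptimal hGZ hKo hMN hGZK hmod hnf hFH hCM8
      hCassels hManinOpt⟩

end Summit.BirchSwinnertonDyer.BirchSwinnertonDyer.Theorems.InertBadAtThreeEveryCurve

end
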